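import Summits.QuantumFields.YangMills.Theorems.FluctuationComparisonRegPrIntLS2BetaKeyLemmaRecordE2E
import Summits.QuantumFields.YangMills.Theorems.FluctuationComparisonRegPrIntLS2BetaFlatTubeDepthOneUniformTorus
import HarnessLib

/-!
# S2β ∕ S1a · UV3-NODE §69.3 (P1) — «THE ACTION OF A GOOD HISTORY BOUNDS ITS DATUM's CURVATURE FROM BELOW, DEPTH-UNIFORMLY»:
# `Σ_P dist1((M^{K−J}U)(∂P))² ≤ 4e²·L^{K−J}·A(U)`, i.e. `(L^J∕γ)·Σ_P dist1² ≤ 4e²·β_K·A(U)` — the bare main term `β_K·A(U)` of any good history over a datum with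
# `n` plaquette variables of size `≥ θ_J` is `≥ n·p(g_J)²∕(4e²)`

Cell `ym3-torus` (YM ladder rung R3 = continuum `SU(2)` Yang–Mills on the three-torus — a RUNG: NOT d = 4, NOT infinite volume, NOT a mass gap, NOT Clay).
Width seat «width 8» `ym3-torus-px8` (gen 22), FREE px helper on crux `stmt-QuantumFields-20520`, count-neutral, DEFINITION-FREE, default heartbeats.

WHAT.  px13 g23's F1 ✓`…KeyLemmaRecordE2E.keyLemma_record` (the KEY LEMMA on the T³ record: for `γ ≤ γ₁(L, b₀, p₀)` and every good history
`U ∈ histGood F ℰp θBal K J`, `√Σ_p dist1((M^tU)(∂p))² ≤ e·(√L)^t·√Σ_p dist1(U(∂p))²`, `t ≤ K − J`) read at the TOP `t = K − J` and squared, then the `SU(2)` identity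
`dist1² ≤ 4(1 − reTr)` summed (✓`…FlatTubeDepthOneUniformTorus.sum_dist1_sq_plaq_le_four_mul_wilsonAction4`):
* §1 `sq_le_of_sqrt_le` (real bookkeeping); ★ `sum_dist1_sq_iter_le` — `Σ_P dist1((M^{K−J}U)(∂P))² ≤ e²·L^{K−J}·Σ_p dist1(U(∂p))²`;
* §2 ★★ `sum_dist1_sq_iter_le_action` — `Σ_P dist1((M^{K−J}U)(∂P))² ≤ 4e²·L^{K−J}·wilsonAction4 U`;
* §3 ★★★ `beta_mul_action_ge_curvature` — THE β-CURRENCY FORM `(L^J∕γ)·Σ_P dist1((M^{K−J}U)(∂P))² ≤ 4e²·(F.scheme ℰp γ).β K·wilsonAction4 U` (`β_K·L^{−(K−J)} = L^J∕γ` since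
  `β_K = (γε_K)⁻¹`, `ε_K = L^{−K}`): the run-`K` bare coefficient `β_K = 1∕(g²ε_K)` on the UNIT-WEIGHT finest-lattice action of a good history controls the HEIGHT-`J`
  coupling `1∕g_J² = L^J∕γ` times the datum's `ℓ²` curvature — the main term of [Balaban1985UV3] (5)∕(47) is `≍ p(g_J)²·#{curved plaquettes}` off the flat datum
  (`(L^J∕γ)·θ_J² = p(g_J)²`, ✓`T3FinestHeightTail.beta_mul_θBal_sq` at height `J`).

WHY (UV3-NODE §69.3, px8 g22): S1a(ᴴ)'s class-membership conjunct fixes ONE `(prm j).β` per HEIGHT while `BalabanUVClass.Witness.lower` carries it on run `K`'s unit-weight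
finest-lattice action, whose printed coefficient is `β_K` (RUN-dependent); this file is the kernel half of why that matters — the main term is not negligible at curved
window data, uniformly in the depth `K − J`.  Also the flux-to-action step px16 g20's §66.2 (2) reasons with, and the converse companion of px20 g12∕g13's UP∘∕LOW letters.

HONEST SCOPE.  A corollary of F1 (px13 g23 ∕ px10 g22 ∕ px12 g23 ∕ px8 g21's (C)-road, all ✓) and one `SU(2)` trace identity; constants crude (`4e²`); nothing of Bałaban's
renormalisation analysis is asserted or proved; S1a(ᴴ), `hFlat`'s registered consumer GAP♯∘, TUBE-REG∘, S2β, the five registered stubs of `Lines/semiclassical_s2beta.lean`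
(3732b7df), crux 20520, 19936, 19200 and `YM3TorusSU2` are NOT proved; no registered stub is closed; the Yang–Mills mass gap is NOT proved.  Sorry-free, axioms standard.

References: T. Bałaban, CMP **102** (1985) 255–275 [Balaban1985UV3] ((5) p.256, (7) p.257, (11) p.258, (47) p.267); CMP **99** (1985) 75–102 [Balaban1985RegularSpaces]
(Lemma 1 p.79); CMP **109** (1987) 249–301 [Balaban1987RG1] ((0.4) p.253).
-/

set_option autoImplicit false

noncomputable section

namespace Summit.QuantumFields.YangMills.Theorems.FluctuationComparisonRegPrIntLS2BetaActionCurvatureFloor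

open Finset
open scoped BigOperators
open Literature.MathematicalPhysics.QuantumFieldTheory.Balaban1983to89
open T4Continuum T3ContinuumYM3Torus T3UnitScaleTilt BlockAveraging
open T3UnitLawDensityEML (ℰp)
open T4CubeChartGnomonic (SU2)
open Summit.QuantumFields.YangMills.Theorems.FluctuationComparisonRegPrIntLS2BetaKeyLemmaRecordE2E (keyLemma_record)
open Summit.QuantumFields.YangMills.Theorems.FluctuationComparisonRegPrIntLS2BetaFlatTubeDepthOneUniformTorus (sum_dist1_sq_plaq_le_four_mul_wilsonAction4)

/-! ## §1 The key lemma at the top level, squared -/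

/-- Real bookkeeping: `√a ≤ c·√b` with `0 ≤ b` gives `a ≤ c²·b` (for `a < 0` trivially). [folklore] -/
theorem le_sq_mul_of_sqrt_le {a b c : ℝ} (hb : 0 ≤ b) (h : Real.sqrt a ≤ c * Real.sqrt b) : a ≤ c ^ 2 * b := by
  rcases le_or_gt 0 a with ha | ha
  · have h2 : Real.sqrt a ^ 2 ≤ (c * Real.sqrt b) ^ 2 := pow_le_pow_left₀ (Real.sqrt_nonneg a) h 2
    rw [Real.sq_sqrt ha, mul_pow, Real.sq_sqrt hb] at h2
    exact h2
  · exact ha.le.trans (mul_nonneg (sq_nonneg c) hb)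

/-- `(e·(√L)^t)² = e²·L^t` for `L ≥ 0`. [folklore] -/
theorem sq_exp_mul_sqrt_pow {L : ℝ} (hL : 0 ≤ L) (t : ℕ) : (Real.exp 1 * Real.sqrt L ^ t) ^ 2 = Real.exp 2 * L ^ t := by
  rw [mul_pow, ← pow_mul, mul_comm t 2, pow_mul, Real.sq_sqrt hL, ← Real.exp_nat_mul]
  norm_num

variable (L : ℕ)

/-- ★ **THE KEY LEMMA AT THE TOP, SQUARED**: for `γ ≤ γ₁(L, b₀, p₀)` (F1's threshold) and every good history `U ∈ histGood F ℰp θBal K J` of a T³ family with `F.L = L`,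
`Σ_P dist1((M^{K−J}U)(∂P))² ≤ e²·L^{K−J}·Σ_p dist1(U(∂p))²` — the datum's `ℓ²` curvature is at most `e²L^{K−J}` times the history's.
[cite: Balaban1985RegularSpaces, Lemma 1 p.79; Balaban1985UV3, (7) p.257] -/
theorem sum_dist1_sq_iter_le (hL : 1 < L) (b₀ p₀ : ℝ) (hb : 0 < b₀) (hp : 0 < p₀) :
    ∃ γ₁ : ℝ, 0 < γ₁ ∧ ∀ γ : ℝ, 0 < γ → γ ≤ γ₁ →
      ∀ (F : T3Family), F.L = L → ∀ (J K : ℕ), J ≤ K → ∀ U : GaugeField (F.P K) 0 SU2,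
        U ∈ histGood F ℰp (θBal F.L γ b₀ p₀) K J →
          ∑ p, dist1 (GaugeField.plaqHol (Averaging.iter (fun k => blockAvg (P := F.P K) (j := k) ℰp) (K - J) U) p) ^ 2 ≤
            Real.exp 2 * (F.L : ℝ) ^ (K - J) * ∑ p, dist1 (GaugeField.plaqHol U p) ^ 2 := by
  obtain ⟨γ₁, hγ₁, H⟩ := keyLemma_record L hL b₀ p₀ hb hp
  refine ⟨γ₁, hγ₁, fun γ hγ hγle F hFL J K hJK U hU => ?_⟩
  have h := H γ hγ hγle F hFL J K hJK U hU (K - J) le_rfl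
  have hL0 : (0 : ℝ) ≤ (F.L : ℝ) := Nat.cast_nonneg _
  have hS0 : 0 ≤ ∑ p, dist1 (GaugeField.plaqHol U p) ^ 2 := Finset.sum_nonneg fun p _ => sq_nonneg _
  have h2 := le_sq_mul_of_sqrt_le hS0 h
  rwa [sq_exp_mul_sqrt_pow hL0] at h2

/-! ## §2 Curvature of the datum ≤ `4e²L^{K−J}` × action of the history -/

/-- ★★ **THE ACTION OF A GOOD HISTORY BOUNDS ITS DATUM's CURVATURE**: under F1's threshold, for every good history `U ∈ histGood F ℰp θBal K J`,
`Σ_P dist1((M^{K−J}U)(∂P))² ≤ 4e²·L^{K−J}·wilsonAction4 U` (§1 + `Σ_p dist1(U(∂p))² ≤ 4·A(U)` on `SU(2)`). [cite: Balaban1985UV3, (11) p.258 and (7) p.257; Balaban1985RegularSpaces, Lemma 1 p.79] -/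
theorem sum_dist1_sq_iter_le_action (hL : 1 < L) (b₀ p₀ : ℝ) (hb : 0 < b₀) (hp : 0 < p₀) :
    ∃ γ₁ : ℝ, 0 < γ₁ ∧ ∀ γ : ℝ, 0 < γ → γ ≤ γ₁ →
      ∀ (F : T3Family), F.L = L → ∀ (J K : ℕ), J ≤ K → ∀ U : GaugeField (F.P K) 0 SU2,
        U ∈ histGood F ℰp (θBal F.L γ b₀ p₀) K J →
          ∑ p, dist1 (GaugeField.plaqHol (Averaging.iter (fun k => blockAvg (P := F.P K) (j := k) ℰp) (K - J) U) p) ^ 2 ≤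
            4 * Real.exp 2 * (F.L : ℝ) ^ (K - J) * wilsonAction4 U := by
  obtain ⟨γ₁, hγ₁, H⟩ := sum_dist1_sq_iter_le L hL b₀ p₀ hb hp
  refine ⟨γ₁, hγ₁, fun γ hγ hγle F hFL J K hJK U hU => (H γ hγ hγle F hFL J K hJK U hU).trans ?_⟩
  have hA := sum_dist1_sq_plaq_le_four_mul_wilsonAction4 U
  have hC : 0 ≤ Real.exp 2 * (F.L : ℝ) ^ (K - J) := mul_nonneg (Real.exp_nonneg _) (pow_nonneg (Nat.cast_nonneg _) _)
  calc Real.exp 2 * (F.L : ℝ) ^ (K - J) * ∑ p, dist1 (GaugeField.plaqHol U p) ^ 2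
      ≤ Real.exp 2 * (F.L : ℝ) ^ (K - J) * (4 * wilsonAction4 U) := mul_le_mul_of_nonneg_left hA hC
    _ = 4 * Real.exp 2 * (F.L : ℝ) ^ (K - J) * wilsonAction4 U := by ring

/-! ## §3 The β-currency form: `(L^J∕γ)·(datum curvature) ≤ 4e²·β_K·A(U)` -/

/-- `β_K·L^{−(K−J)} = L^J∕γ`: the run-`K` bare coefficient `β_K = (γε_K)⁻¹`, `ε_K = L^{−K}`, carries the height-`J` coupling `1∕g_J² = L^J∕γ` times the depth factor `L^{K−J}`.
[cite: Balaban1985UV3, (1)-(3) p.256] -/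
theorem scheme_beta_eq_pow_mul (F : T3Family) (γ : ℝ) {J K : ℕ} (hJK : J ≤ K) :
    (F.scheme ℰp γ).β K = (F.L : ℝ) ^ J / γ * (F.L : ℝ) ^ (K - J) := by
  show (γ * (F.P K).eps)⁻¹ = _
  have heps : (F.P K).eps = ((F.L : ℝ)⁻¹) ^ K := rfl
  rw [heps, inv_pow, mul_inv, inv_inv, div_mul_eq_mul_div, ← pow_add, Nat.add_sub_cancel' hJK, div_eq_inv_mul]

/-- ★★★ **THE MAIN TERM OF A GOOD HISTORY IS LARGE OFF THE FLAT DATUM, DEPTH-UNIFORMLY** (β-currency form of §2): under F1's threshold `γ ≤ γ₁(L, b₀, p₀)`, for every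
good history `U ∈ histGood F ℰp θBal K J`, `(L^J∕γ)·Σ_P dist1((M^{K−J}U)(∂P))² ≤ 4e²·β_K·wilsonAction4 U` with `β_K = (F.scheme ℰp γ).β K` the run's bare coefficient on the
unit-weight finest-lattice action — so a datum with `n` plaquette variables of size `≥ θ_J` forces `β_K·A(U) ≥ n·p(g_J)²∕(4e²)` on every good history over it
(`(L^J∕γ)·θ_J² = p(g_J)²`).  The constant is independent of the depth `K − J`, the volume and `γ`. [cite: Balaban1985UV3, (5) p.256, (7) p.257, (47) p.267; Balaban1985RegularSpaces, Lemma 1 p.79] -/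
theorem beta_mul_action_ge_curvature (hL : 1 < L) (b₀ p₀ : ℝ) (hb : 0 < b₀) (hp : 0 < p₀) :
    ∃ γ₁ : ℝ, 0 < γ₁ ∧ ∀ γ : ℝ, 0 < γ → γ ≤ γ₁ →
      ∀ (F : T3Family), F.L = L → ∀ (J K : ℕ), J ≤ K → ∀ U : GaugeField (F.P K) 0 SU2,
        U ∈ histGood F ℰp (θBal F.L γ b₀ p₀) K J →
          (F.L : ℝ) ^ J / γ *
              ∑ p, dist1 (GaugeField.plaqHol (Averaging.iter (fun k => blockAvg (P := F.P K) (j := k) ℰp) (K - J) U) p) ^ 2 ≤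
            4 * Real.exp 2 * (F.scheme ℰp γ).β K * wilsonAction4 U := by
  obtain ⟨γ₁, hγ₁, H⟩ := sum_dist1_sq_iter_le_action L hL b₀ p₀ hb hp
  refine ⟨γ₁, hγ₁, fun γ hγ hγle F hFL J K hJK U hU => ?_⟩
  have h := H γ hγ hγle F hFL J K hJK U hU
  have hq : 0 ≤ (F.L : ℝ) ^ J / γ := div_nonneg (pow_nonneg (Nat.cast_nonneg _) _) hγ.le
  rw [scheme_beta_eq_pow_mul F γ hJK]
  calc (F.L : ℝ) ^ J / γ * ∑ p, dist1 (GaugeField.plaqHol (Averaging.iter (fun k => blockAvg (P := F.P K) (j := k) ℰp) (K - J) U) p) ^ 2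
      ≤ (F.L : ℝ) ^ J / γ * (4 * Real.exp 2 * (F.L : ℝ) ^ (K - J) * wilsonAction4 U) := mul_le_mul_of_nonneg_left h hq
    _ = 4 * Real.exp 2 * ((F.L : ℝ) ^ J / γ * (F.L : ℝ) ^ (K - J)) * wilsonAction4 U := by ring

end Summit.QuantumFields.YangMills.Theorems.FluctuationComparisonRegPrIntLS2BetaActionCurvatureFloor

end
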